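import Mathlib
import Summits.KontsevichZagierPeriods.Zeta5Search.RecordCellADigitsS
import Summits.KontsevichZagierPeriods.Zeta5Search.RecordCellAAtlasNotMin
import Summits.KontsevichZagierPeriods.Zeta5Search.RecordCellAtlas
import HarnessLib

/-!
# ζ(5) search — RECORD CELL A is a THEOREM: `v_p(Cas₇(b(n))) ≥ −4` for `14n < p < 15n` on the Brown–Zudilin record ray

Cell `pub-zeta5` (HONEST FRAMING: systematic search; no irrationality claim unless certified), P1 prover seat
generation 5.  Census g11 (`STRUCTURE §15.4`, typed as `CellAtlas.RecordCellA`) located the heaviest cell of the record's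
missing denominator law: for `b(n) = n·(41;17,16,15,14,13,12,11)` and a prime `14n < p < 15n` the tree proves
`v_p(Cas₇(b(n))) ≥ −5` (THEOREM LB `casoratianClassBound_holds`, `casLB = −5` there) while the truth is `−4` (26/26 instances,
worth 1.000 nats/step).  This file proves **`v_p(Cas₇(b(n))) ≥ −4` for all `n ≥ 2`** (`recordCellA`) — the first MINOR-LEVEL
(non-termwise) valuation law in the tree; it is gen-2 g8's Lemma-D bonus / THEOREM LB♯♯ on this cell (REPORT-gen2-g8 §3.9,
class-structure lemma REPORT-gen2-g9 §2.2), proved here by a Fermat-quotient-free route: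

* `Cas₇ = W(b⁺)V(b) − W(b)V(b⁺)` is regrouped by residue classes (`W = Σ_x W_x`, `V = Σ_x V_x`); outside the minimal classes
  `Min = MinA ∪ MinS ∪ MinAbar` every `W_x(b′)` is `p`-integral (Theorems A/A′ with `E_x ≥ −3`) and `‖V_x(b′)‖ ≤ p³`
  (`ClassNuBound`, `ν_x ≥ −3` by the atlas; `b′ ∈ {b, b+e₇}` via the shift monotonicity of THEOREM LB part 1);
* on `Min` the digit packages give `‖p·W_M(b′)‖, ‖p⁴·V_M(b′)‖ ≤ 1` and THE congruence `p·W_M(b′) ≡ p⁴·V_M(b′) (mod p)` for `b`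
  and `b+e₇` SEPARATELY (pairs `x, x̄`: type `(1,3)` both sides `≡ −2g`, type `(2,2)` both `≡ 0`);
* hence `p⁵·Cas₇ = A′(B−A) − A(B′−A′) + p·(…) ≡ 0 (mod p)` with `A = pW_M`, `B = p⁴V_M`: `‖Cas₇‖_p ≤ p⁴`.
`recordCellA_holds : CellAtlas.RecordCellA` discharges census g11's statement BY NAME.  Valuations of rational numbers;
nothing about irrationality.
-/

noncomputable section

open Finset

namespace Summit.KontsevichZagierPeriods.Zeta5Search.CellA

open Summit.KontsevichZagierPeriods.Zeta5Search.DualSeries (InBox)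
open Summit.KontsevichZagierPeriods.Zeta5Search.WedgeDictionary (pfData coeffW coeffV)
open Summit.KontsevichZagierPeriods.Zeta5Search.CasoratianValuation (InPolytope shift casoratian)
open Summit.KontsevichZagierPeriods.Zeta5Search.ClusterValuation
open Summit.KontsevichZagierPeriods.Zeta5Search.PadicSeries
open Summit.KontsevichZagierPeriods.Zeta5Search.BigPrime (shift_zero padicNorm_mul_le_one)

variable {p : ℕ} [hp : Fact p.Prime]

/-! ### §1 Per-class bounds outside the minimal classes -/

/-- **`W_x` is `p`-integral** when the class has no pole, one pole (Theorem A′), or class exponent `≥ −3` (Theorem A). -/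
theorem padicNorm_classW_le_one (b : ℕ → ℤ) (hb : InPolytope b) (hp5 : 5 ≤ p) (hwin : (b 0 + 2 : ℤ) < (p : ℤ) ^ 2)
    {x : ℕ} (hE : 2 ≤ classPoleCount b p x → -3 ≤ classExp b p x) : padicNorm p (classW b p x) ≤ 1 := by
  unfold classW
  refine padicNorm.sum_le' (fun q hq => ?_) zero_le_one
  have hqn : q ≤ (b 0).toNat := ((mem_classSet_iff b x q).1 hq).1
  by_cases hreg : 0 ≤ netExp b q
  · rw [pfData_eq_zero_of_netExp_nonneg b hb hqn hreg (by norm_num : 2 < 6), padicNorm.zero]; exact zero_le_one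
  · push Not at hreg
    have h1 := padicNorm_le_of_val (p := p) (x := pfData b 2 q) (m := 0) (fun hne => ?_)
    · simpa using h1
    have hcount : classPoleCount b p q = classPoleCount b p x := by
      unfold classPoleCount; rw [classSet_eq_of_mem hq]
    have hpos : 1 ≤ classPoleCount b p x := by
      unfold classPoleCount
      exact card_pos.2 ⟨q, mem_filter.2 ⟨hq, hreg⟩⟩
    by_cases hone : classPoleCount b p x = 1
    · exact isolatedPoleIntegral_holds b p q 2 hb hp.out (by omega) hwin hqn (by norm_num) hne (by rw [hcount, hone])
    · have hA := clusterBound_holds b p q 2 hb hp.out (by omega) hwin hqn (by norm_num) hne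
      rw [classExp_eq_of_mem hq] at hA
      have := hE (by omega)
      push_cast at hA
      linarith

/-- **`‖V_x‖ ≤ p³`** for a class with `ν_x ≥ −3` (or without poles). -/
theorem padicNorm_classV_le_cube (b : ℕ → ℤ) (hb : InPolytope b) (hp5 : 5 ≤ p) (hwin : (b 0 + 2 : ℤ) < (p : ℤ) ^ 2)
    {x : ℕ} (hx : x < p) (hν : 1 ≤ classPoleCount b p x → -3 ≤ classNu b p x) :
    padicNorm p (classV b p x) ≤ (p : ℚ) ^ (3 : ℤ) := by
  rcases Nat.eq_zero_or_pos (classPoleCount b p x) with h0 | hpos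
  · rw [classV_eq_zero_of_noPole b hb h0, padicNorm.zero]; exact zpow_p_nonneg _
  · exact (padicNorm_classV_le b hb hp5 hwin hx hpos).trans (zpow_le_zpow_right₀ one_le_p (by linarith [hν hpos]))

/-! ### §2 The two halves of `W` and `V` -/

/-- The minimal part of `W`: `W_M = Σ_{x ∈ Min} W_x`. -/
def WM (n p : ℕ) (b : ℕ → ℤ) : ℚ := ∑ x ∈ MinAll n p, classW b p x
/-- The rest of `W`. -/
def WR (n p : ℕ) (b : ℕ → ℤ) : ℚ := ∑ x ∈ range p \ MinAll n p, classW b p x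
/-- The minimal part of `V`. -/
def VM (n p : ℕ) (b : ℕ → ℤ) : ℚ := ∑ x ∈ MinAll n p, classV b p x
/-- The rest of `V`. -/
def VR (n p : ℕ) (b : ℕ → ℤ) : ℚ := ∑ x ∈ range p \ MinAll n p, classV b p x

omit hp in
/-- `W = W_M + W_R`. -/
theorem coeffW_split (n : ℕ) {p : ℕ} (hp0 : 0 < p) (b : ℕ → ℤ) : coeffW b = WM n p b + WR n p b := by
  rw [coeffW_eq_sum_classW b hp0, WM, WR, ← sum_union disjoint_sdiff, union_sdiff_of_subset (minAll_subset n p)]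

omit hp in
/-- `V = V_M + V_R`. -/
theorem coeffV_split (n : ℕ) {p : ℕ} (hp0 : 0 < p) (b : ℕ → ℤ) : coeffV b = VM n p b + VR n p b := by
  rw [coeffV_eq_sum_classV b hp0, VM, VR, ← sum_union disjoint_sdiff, union_sdiff_of_subset (minAll_subset n p)]

/-! ### §3 The minimal block: integrality and THE congruence, for any `b′` with the record class data -/

section MinBlock

variable {n : ℕ} (hp14 : 14 * n < p) (hp15 : p < 15 * n) (hp5 : 5 ≤ p)
  (b : ℕ → ℤ) (hb : InPolytope b) (hwin : (b 0 + 2 : ℤ) < (p : ℤ) ^ 2) (hN : (b 0).toNat = 41 * n)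
  (hA : ∀ x ∈ MinA n p, netExp b x = -1 ∧ netExp b (x + p) = -3)
  (hS : ∀ x ∈ MinS n p, netExp b x = -2 ∧ netExp b (x + p) = -2)

include hp5 hb hwin hN hA in
/-- The digit package of a class of `MinA` (and of its conjugate in `MinAbar`). -/
theorem packA {x : ℕ} (hx : x ∈ MinA n p) :
    padicNorm p ((p : ℚ) * classW b p x) ≤ 1 ∧ padicNorm p ((p : ℚ) ^ 4 * classV b p x) ≤ 1 ∧
    padicNorm p ((p : ℚ) * classW b p (41 * n - (x + p))) ≤ 1 ∧
    padicNorm p ((p : ℚ) ^ 4 * classV b p (41 * n - (x + p))) ≤ 1 ∧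
    padicNorm p (digitDefect b p x + digitDefect b p (41 * n - (x + p))) ≤ (p : ℚ) ^ (-(1 : ℤ)) := by
  have hx' := mem_minA.1 hx
  obtain ⟨e0, e1⟩ := hA x hx
  have h := digitA_pair b hb hp5 hwin (q₀ := x) hx'.1 (by rw [hN]; omega) (by rw [hN]; omega) e0 e1
  rw [hN] at h
  exact h

include hp14 hp5 hb hwin hN hS in
/-- The digit package of a class of `MinS` (and of its conjugate, again in `MinS`). -/
theorem packS {x : ℕ} (hx : x ∈ MinS n p) :
    padicNorm p ((p : ℚ) * classW b p x) ≤ 1 ∧ padicNorm p ((p : ℚ) ^ 4 * classV b p x) ≤ 1 ∧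
    padicNorm p ((p : ℚ) * classW b p (41 * n - (x + p))) ≤ 1 ∧
    padicNorm p ((p : ℚ) ^ 4 * classV b p (41 * n - (x + p))) ≤ 1 ∧
    padicNorm p (digitDefect b p x + digitDefect b p (41 * n - (x + p))) ≤ (p : ℚ) ^ (-(1 : ℤ)) := by
  have hx' := mem_minS.1 hx
  obtain ⟨e0, e1⟩ := hS x hx
  have h := digitS_pair b hb hp5 hwin (q₀ := x) hx'.1 (by rw [hN]; omega) (by rw [hN]; omega) e0 e1
  rw [hN] at h
  exact h

include hp14 in
omit hp in
/-- A sum over `MinAbar` is the sum over `MinA` of the conjugates. -/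
theorem sum_minAbar_eq (f : ℕ → ℚ) : ∑ x ∈ MinAbar n p, f x = ∑ x ∈ MinA n p, f (41 * n - (x + p)) := by
  refine (sum_nbij' (fun x => 41 * n - (x + p)) (fun x => 41 * n - (x + p)) (fun x hx => conj_mem_minAbar hx)
    (fun x hx => conj_mem_minA hp14 hx) (fun x hx => ?_) (fun x hx => ?_) (fun x hx => rfl)).symm
  · have := mem_minA.1 hx; omega
  · have := mem_minAbar.1 hx; omega

include hp14 in
omit hp in
/-- A sum over `MinS` equals the sum of the conjugates. -/
theorem sum_minS_conj (f : ℕ → ℚ) : ∑ x ∈ MinS n p, f (41 * n - (x + p)) = ∑ x ∈ MinS n p, f x :=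
  sum_nbij' (fun x => 41 * n - (x + p)) (fun x => 41 * n - (x + p)) (fun x hx => conj_mem_minS hp14 hx)
    (fun x hx => conj_mem_minS hp14 hx) (fun x hx => by have := mem_minS.1 hx; omega)
    (fun x hx => by have := mem_minS.1 hx; omega) (fun x hx => rfl)

include hp14 hp15 in
omit hp in
/-- Splitting a sum over `MinAll` into conjugate pairs of `MinA ∪ MinAbar` and the classes of `MinS`. -/
theorem sum_minAll (f : ℕ → ℚ) :
    ∑ x ∈ MinAll n p, f x = ∑ x ∈ MinA n p, (f x + f (41 * n - (x + p))) + ∑ x ∈ MinS n p, f x := by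
  rw [MinAll, sum_union (disjoint_minAS_minAbar hp15), sum_union (disjoint_minA_minS n p), sum_minAbar_eq hp14,
    sum_add_distrib]
  ring

include hp14 hp15 hp5 hb hwin hN hA hS in
/-- **`‖p·W_M‖ ≤ 1`.** -/
theorem padicNorm_WM_le : padicNorm p ((p : ℚ) * WM n p b) ≤ 1 := by
  rw [WM, mul_sum, sum_minAll hp14 hp15]
  refine nI_add (padicNorm.sum_le' (fun x hx => ?_) zero_le_one) (padicNorm.sum_le' (fun x hx => ?_) zero_le_one)
  · obtain ⟨h1, -, h3, -, -⟩ := packA hp5 b hb hwin hN hA hx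
    exact nI_add h1 h3
  · exact (packS hp14 hp5 b hb hwin hN hS hx).1

include hp14 hp15 hp5 hb hwin hN hA hS in
/-- **`‖p⁴·V_M‖ ≤ 1`.** -/
theorem padicNorm_VM_le : padicNorm p ((p : ℚ) ^ 4 * VM n p b) ≤ 1 := by
  rw [VM, mul_sum, sum_minAll hp14 hp15]
  refine nI_add (padicNorm.sum_le' (fun x hx => ?_) zero_le_one) (padicNorm.sum_le' (fun x hx => ?_) zero_le_one)
  · obtain ⟨-, h2, -, h4, -⟩ := packA hp5 b hb hwin hN hA hx
    exact nI_add h2 h4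
  · exact (packS hp14 hp5 b hb hwin hN hS hx).2.1

include hp14 hp15 hp5 hb hwin hN hA hS in
/-- **THE CONGRUENCE `p·W_M ≡ p⁴·V_M (mod p)`.** -/
theorem padicNorm_WM_sub_VM_le :
    padicNorm p ((p : ℚ) * WM n p b - (p : ℚ) ^ 4 * VM n p b) ≤ (p : ℚ) ^ (-(1 : ℤ)) := by
  have e : (p : ℚ) * WM n p b - (p : ℚ) ^ 4 * VM n p b = ∑ x ∈ MinAll n p, digitDefect b p x := by
    rw [WM, VM, mul_sum, mul_sum, ← sum_sub_distrib]; rfl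
  rw [e, sum_minAll hp14 hp15]
  refine small_add (padicNorm.sum_le' (fun x hx => (packA hp5 b hb hwin hN hA hx).2.2.2.2) (zpow_p_nonneg _)) ?_
  -- the `MinS` part: twice the sum is the sum over conjugate pairs
  have h2 : (2 : ℚ) * ∑ x ∈ MinS n p, digitDefect b p x =
      ∑ x ∈ MinS n p, (digitDefect b p x + digitDefect b p (41 * n - (x + p))) := by
    rw [sum_add_distrib, sum_minS_conj hp14, two_mul]
  have hb2 : padicNorm p ((2 : ℚ) * ∑ x ∈ MinS n p, digitDefect b p x) ≤ (p : ℚ) ^ (-(1 : ℤ)) := by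
    rw [h2]
    exact padicNorm.sum_le' (fun x hx => (packS hp14 hp5 b hb hwin hN hS hx).2.2.2.2) (zpow_p_nonneg _)
  have htwo : padicNorm p (2 : ℚ) = 1 := by
    have hp2 : p ≠ 2 := by omega
    have := (padicNorm.nat_eq_one_iff (p := p) 2).2 (by
      intro h
      exact hp2 ((Nat.prime_dvd_prime_iff_eq hp.out Nat.prime_two).1 h))
    exact_mod_cast this
  rw [padicNorm.mul, htwo, one_mul] at hb2
  exact hb2

end MinBlock

/-! ### §4 The rest: `‖W_R‖ ≤ 1`, `‖V_R‖ ≤ p³` for `b(n)` and `b(n) + e₇` -/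

section Rest

variable {n : ℕ} (hn : 1 ≤ n) (hp14 : 14 * n < p) (hp15 : p < 15 * n) (hp5 : 5 ≤ p)

include hp14 hp15 in
omit hp in
/-- The window inequality `41n + 2 < p²` on the cell. -/
theorem window_bRec : (bRec n 0 + 2 : ℤ) < (p : ℤ) ^ 2 := by
  rw [bRec_zero]; nlinarith

include hn hp14 hp15 in
/-- The hypotheses of §1 for `b(n)` on the non-minimal classes. -/
theorem rest_data_bRec {x : ℕ} (hx : x ∈ range p \ MinAll n p) :
    x < p ∧ (1 ≤ classPoleCount (bRec n) p x → -3 ≤ classNu (bRec n) p x) ∧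
      (2 ≤ classPoleCount (bRec n) p x → -3 ≤ classExp (bRec n) p x) := by
  rw [mem_sdiff, mem_range, MinAll, mem_union, mem_union, not_or, not_or] at hx
  obtain ⟨hxp, ⟨hA, hS⟩, hB⟩ := hx
  have hodd : ¬ 2 ∣ p := fun h => by
    have := (Nat.prime_dvd_prime_iff_eq Nat.prime_two hp.out).1 h; omega
  have hν := classNu_ge_of_notMin hn hp14 hp15 hxp hodd hA hS hB
  refine ⟨hxp, fun _ => hν, fun h2 => ?_⟩
  have : classNu (bRec n) p x = classExp (bRec n) p x := by
    unfold classNu; rw [if_neg (by omega)]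
  rw [← this]; exact hν

include hn hp14 hp15 hp5 in
/-- **`‖W_R(b(n))‖ ≤ 1` and `‖V_R(b(n))‖ ≤ p³`.** -/
theorem rest_bRec : padicNorm p (WR n p (bRec n)) ≤ 1 ∧ padicNorm p (VR n p (bRec n)) ≤ (p : ℚ) ^ (3 : ℤ) := by
  have hb := inPolytope_bRec n
  have hwin := window_bRec (p := p) hp14 hp15
  refine ⟨padicNorm.sum_le' (fun x hx => ?_) zero_le_one, padicNorm.sum_le' (fun x hx => ?_) (zpow_p_nonneg _)⟩
  · obtain ⟨-, -, hE⟩ := rest_data_bRec hn hp14 hp15 hx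
    exact padicNorm_classW_le_one _ hb hp5 hwin hE
  · obtain ⟨hxp, hν, -⟩ := rest_data_bRec hn hp14 hp15 hx
    exact padicNorm_classV_le_cube _ hb hp5 hwin hxp hν

include hn hp14 hp15 hp5 in
/-- **`‖W_R(b(n)+e₇)‖ ≤ 1` and `‖V_R(b(n)+e₇)‖ ≤ p³`** (shift monotonicity of the class data). -/
theorem rest_shift : padicNorm p (WR n p (shift (bRec n) 7)) ≤ 1 ∧
    padicNorm p (VR n p (shift (bRec n) 7)) ≤ (p : ℚ) ^ (3 : ℤ) := by
  have hb := inPolytope_bRec n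
  have hb' := inPolytope_shift_bRec n 7 hn (by norm_num) (by norm_num)
  have hwin := window_bRec (p := p) hp14 hp15
  have hwin' : (shift (bRec n) 7 0 + 2 : ℤ) < (p : ℤ) ^ 2 := by rw [shift_zero _ (by norm_num)]; exact hwin
  have hcnt : ∀ x, classPoleCount (shift (bRec n) 7) p x ≤ classPoleCount (bRec n) p x :=
    fun x => classPoleCount_shift_le _ hb.1 (by norm_num) p x
  refine ⟨padicNorm.sum_le' (fun x hx => ?_) zero_le_one, padicNorm.sum_le' (fun x hx => ?_) (zpow_p_nonneg _)⟩
  · obtain ⟨-, -, hE⟩ := rest_data_bRec hn hp14 hp15 hx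
    refine padicNorm_classW_le_one _ hb' hp5 hwin' fun h2 => ?_
    exact (hE (h2.trans (hcnt x))).trans (classExp_shift_ge _ hb.1 (by norm_num) p x)
  · obtain ⟨hxp, hν, -⟩ := rest_data_bRec hn hp14 hp15 hx
    refine padicNorm_classV_le_cube _ hb' hp5 hwin' hxp fun h1 => ?_
    exact (hν (h1.trans (hcnt x))).trans (classNu_shift_ge _ hb.1 (by norm_num) h1)

end Rest

/-! ### §5 RECORD CELL A -/

/-- **RECORD CELL A (census g11) is a THEOREM.**  For `n ≥ 2` and every prime `14n < p < 15n`: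
`v_p(W(b⁺)V(b) − W(b)V(b⁺)) ≥ −4` for `b = b(n) = n·(41;17,…,11)`, `b⁺ = b + e₇` — one more than THEOREM LB gives
(`casLB = −5`), and the exact value at all 26 instances `n ≤ 16` of census g11.  Literally the statement
`CellAtlas.RecordCellA`. -/
theorem recordCellA : ∀ n p : ℕ, 2 ≤ n → p.Prime → 14 * n < p → p < 15 * n → casoratian (bRec n) 7 ≠ 0 →
    (-4 : ℤ) ≤ padicValRat p (casoratian (bRec n) 7) := by
  intro n p hn2 hprime hp14 hp15 hne
  haveI : Fact p.Prime := ⟨hprime⟩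
  have hn : 1 ≤ n := by omega
  have hp5 : 5 ≤ p := by omega
  set b := bRec n with hbdef
  set b' := shift (bRec n) 7 with hb'def
  have hb : InPolytope b := inPolytope_bRec n
  have hb' : InPolytope b' := inPolytope_shift_bRec n 7 hn (by norm_num) (by norm_num)
  have hwin : (b 0 + 2 : ℤ) < (p : ℤ) ^ 2 := window_bRec hp14 hp15
  have hwin' : (b' 0 + 2 : ℤ) < (p : ℤ) ^ 2 := by rw [hb'def, shift_zero _ (by norm_num)]; exact hwin
  have hN : (b 0).toNat = 41 * n := bRec_zero_toNat n
  have hN' : (b' 0).toNat = 41 * n := shift7_zero_toNat n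
  have hA : ∀ x ∈ MinA n p, netExp b x = -1 ∧ netExp b (x + p) = -3 := fun x hx =>
    let h := netExp_minA hn hp14 hp15 hx; ⟨h.1, h.2.1⟩
  have hS : ∀ x ∈ MinS n p, netExp b x = -2 ∧ netExp b (x + p) = -2 := fun x hx =>
    let h := netExp_minS hn hp14 hp15 hx; ⟨h.1, h.2.1⟩
  have hA' : ∀ x ∈ MinA n p, netExp b' x = -1 ∧ netExp b' (x + p) = -3 := fun x hx =>
    let h := netExp_minA hn hp14 hp15 hx; ⟨h.2.2.1, h.2.2.2.1⟩
  have hS' : ∀ x ∈ MinS n p, netExp b' x = -2 ∧ netExp b' (x + p) = -2 := fun x hx =>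
    let h := netExp_minS hn hp14 hp15 hx; ⟨h.2.2.1, h.2.2.2.1⟩
  -- the eight bounded quantities
  set A := (p : ℚ) * WM n p b with hAdef
  set A' := (p : ℚ) * WM n p b' with hA'def
  set B := (p : ℚ) ^ 4 * VM n p b with hBdef
  set B' := (p : ℚ) ^ 4 * VM n p b' with hB'def
  set C := (p : ℚ) ^ 3 * VR n p b with hCdef
  set C' := (p : ℚ) ^ 3 * VR n p b' with hC'def
  set R := WR n p b with hRdef
  set R' := WR n p b' with hR'def
  have iA : padicNorm p A ≤ 1 := padicNorm_WM_le hp14 hp15 hp5 b hb hwin hN hA hS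
  have iA' : padicNorm p A' ≤ 1 := padicNorm_WM_le hp14 hp15 hp5 b' hb' hwin' hN' hA' hS'
  have iB : padicNorm p B ≤ 1 := padicNorm_VM_le hp14 hp15 hp5 b hb hwin hN hA hS
  have iB' : padicNorm p B' ≤ 1 := padicNorm_VM_le hp14 hp15 hp5 b' hb' hwin' hN' hA' hS'
  have dAB : padicNorm p (A - B) ≤ (p : ℚ) ^ (-(1 : ℤ)) := padicNorm_WM_sub_VM_le hp14 hp15 hp5 b hb hwin hN hA hS
  have dAB' : padicNorm p (A' - B') ≤ (p : ℚ) ^ (-(1 : ℤ)) :=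
    padicNorm_WM_sub_VM_le hp14 hp15 hp5 b' hb' hwin' hN' hA' hS'
  obtain ⟨iR, iVR⟩ := rest_bRec (p := p) hn hp14 hp15 hp5
  obtain ⟨iR', iVR'⟩ := rest_shift (p := p) hn hp14 hp15 hp5
  have hp3 : padicNorm p ((p : ℚ) ^ 3) = ((p : ℚ) ^ 3)⁻¹ := padicNorm_p_pow 3
  have iC : padicNorm p C ≤ 1 := by
    rw [hCdef, padicNorm.mul, hp3]
    calc ((p : ℚ) ^ 3)⁻¹ * padicNorm p (VR n p b) ≤ ((p : ℚ) ^ 3)⁻¹ * (p : ℚ) ^ (3 : ℤ) :=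
          mul_le_mul_of_nonneg_left iVR (inv_nonneg.2 (pow_nonneg (Nat.cast_nonneg _) _))
      _ = 1 := by rw [zpow_ofNat, inv_mul_cancel₀ (pow_ne_zero _ (Nat.cast_ne_zero.2 hprime.ne_zero))]
  have iC' : padicNorm p C' ≤ 1 := by
    rw [hC'def, padicNorm.mul, hp3]
    calc ((p : ℚ) ^ 3)⁻¹ * padicNorm p (VR n p b') ≤ ((p : ℚ) ^ 3)⁻¹ * (p : ℚ) ^ (3 : ℤ) :=
          mul_le_mul_of_nonneg_left iVR' (inv_nonneg.2 (pow_nonneg (Nat.cast_nonneg _) _))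
      _ = 1 := by rw [zpow_ofNat, inv_mul_cancel₀ (pow_ne_zero _ (Nat.cast_ne_zero.2 hprime.ne_zero))]
  -- the identity
  have hp0 : (p : ℚ) ≠ 0 := Nat.cast_ne_zero.2 hprime.ne_zero
  have hW : coeffW b = A / p + R := by
    rw [coeffW_split n hprime.pos b, hAdef, hRdef]; field_simp
  have hW' : coeffW b' = A' / p + R' := by
    rw [coeffW_split n hprime.pos b', hA'def, hR'def]; field_simp
  have hV : coeffV b = B / (p : ℚ) ^ 4 + C / (p : ℚ) ^ 3 := by
    rw [coeffV_split n hprime.pos b, hBdef, hCdef]; field_simp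
  have hV' : coeffV b' = B' / (p : ℚ) ^ 4 + C' / (p : ℚ) ^ 3 := by
    rw [coeffV_split n hprime.pos b', hB'def, hC'def]; field_simp
  have e : (p : ℚ) ^ 5 * casoratian b 7 =
      (A' * (B - A) - A * (B' - A')) + p * (A' * C + R' * B - A * C' - R * B') + (p : ℚ) ^ 2 * (R' * C - R * C') := by
    rw [casoratian, ← hb'def, hW, hW', hV, hV']
    field_simp
    ring
  -- the bound `‖p⁵·Cas‖ ≤ p⁻¹`
  have ip : padicNorm p (p : ℚ) ≤ 1 := nI_nat p
  have h5 : padicNorm p ((p : ℚ) ^ 5 * casoratian b 7) ≤ (p : ℚ) ^ (-(1 : ℤ)) := by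
    rw [e]
    refine small_add (small_add (small_sub (small_mul iA' (by rw [← neg_sub, padicNorm.neg]; exact dAB))
      (small_mul iA (by rw [← neg_sub, padicNorm.neg]; exact dAB'))) (small_p_mul ?_)) ?_
    · exact nI_sub (nI_sub (nI_add (padicNorm_mul_le_one iA' iC) (padicNorm_mul_le_one iR' iB))
        (padicNorm_mul_le_one iA iC')) (padicNorm_mul_le_one iR iB')
    · rw [pow_two, mul_assoc]
      exact small_mul ip (small_p_mul (nI_sub (padicNorm_mul_le_one iR' iC) (padicNorm_mul_le_one iR iC')))
  -- unscale
  apply val_ge_of_padicNorm_le hne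
  have hp5n : padicNorm p ((p : ℚ) ^ 5) = ((p : ℚ) ^ 5)⁻¹ := padicNorm_p_pow 5
  have hpos : (0 : ℚ) < (p : ℚ) ^ 5 := pow_pos (by exact_mod_cast hprime.pos) 5
  rw [padicNorm.mul, hp5n, inv_mul_le_iff₀ hpos] at h5
  refine h5.trans (le_of_eq ?_)
  rw [neg_neg, ← zpow_natCast, ← zpow_add₀ hp0]
  norm_num

/-- **`CellAtlas.RecordCellA` (census g11) is a THEOREM** — discharged by name. -/
theorem recordCellA_holds : CellAtlas.RecordCellA := recordCellA

end Summit.KontsevichZagierPeriods.Zeta5Search.CellA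

end
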